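import Literature.Barriers.AtomisticToContinuum.HardDiskPathSums
import Literature.Barriers.AtomisticToContinuum.HardDiskCutoff
import HarnessLib

/-!
# Richthammer's good configurations `G_n` and Lemma 13 (hard-disc model)

Part of the bottom-up programme for `Richthammer2007_ineq58` (the finite-volume form of (5.8),
`HardDiskTranslationInvarianceFinalSteps.lean`), which is all that is missing for
`Richthammer2007_hardDisk_holds` (`HardDiskTranslationInvarianceReduction.lean`).

Richthammer [Richthammer2007, §5.2–5.3] fixes, for the Gibbs measure `μ`, the cylinder box
`Λ_{n'}`, `ε` with `c_ε z < 1` ((5.1)) and `δ > 0`: an integer `R > n'` with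
`μ(G^a_n) ≥ 1 - δ/2` for all `n > n'`, `G^a_n := {X : r_{n,X}(Λ_{n'}) < R}` (Lemma 7 and "the
Chebyshev inequality"), and the good configurations
`G_n := {X ∈ G^a_n : Σ₁(n,X) + Σ₂(n,X) + Σ₃(n,X) < 1}` ((5.3')), with `Σ₁` of (6.7'),
`Σ₂, Σ₃` of (6.14); Lemma 13: `μ(G_nᶜ) ≤ δ` for `n` large, because the expectations of the `Σ_i`
tend to `0` (§6.8). The two uses of `X ∈ G_n` in the construction are (6.7)
(`|τ_n(|x| - c_K) - τ_n(|x'|)| c_f ≤ 1/2` for connected `x, x'`, from `Σ₁ < 1`), the cluster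
bound `a_{n,X}(x) ∈ Λ_R` for `x ∈ Λ_{n'}` (from `X ∈ G^a_n`), and `Σ₂ + Σ₃ ≤ 1` (Lemma 12).

This file defines the good set through the MEASURABLE path-expansion majorants of §6.1/§6.8
(the tree's `pathSum₁`, `pathSum₃`, `pathSum₁'`, and the majorant of `r_{n,X}(Λ_{n'})` from the
proof of Lemma 7), intersected with the almost sure hard-core event: `goodSet τ R n n' ε` is a
measurable subset of Richthammer's `G_n` (on hard-disc configurations the majorants dominate
`r_{n,X}` and `4c_f² Σ₁ + (2τ²/Q²) Σ₂ + 2c_f² Σ₃`, `sigmaTotal_le_sigmaSum`), it has the three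
properties above (`profile_gap_lt_half`, `supNorm_lt_of_mem_goodSet`, `sigmaTotal_lt_one`), and
Lemma 13 holds for it (`Richthammer2007_lemma13`: `∃ R > n', ∀ᶠ n, μ(goodSetᶜ) ≤ δ`, by Markov's
inequality, the `n`-independent bound of §6.1 and the limits of §6.8). It also provides the point
`a_{n,X}(x)` of maximal norm in the cluster of `x` (`apex`; clusters of the bond graph
`(X, K_n^{X,ε})` are finite).

## References

* [Richthammer2007] T. Richthammer, *Translation-invariance of two-dimensional Gibbsian point
  processes*, Comm. Math. Phys. 274 (2007) 81–122, arXiv:0706.3637: §5.2 Lemma 7 and the choice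
  of `R` (p. 11), §5.3 (5.3') (p. 11), §5.5 Lemma 13 (p. 12), §6.4 (6.7)–(6.7') (p. 15), §6.7
  (6.14) (p. 17), §6.8 (pp. 17–18).
-/

noncomputable section

open MeasureTheory Set Filter
open scoped ENNReal Topology

namespace Literature.Barriers.AtomisticToContinuum.HardDisk

open Literature.Analysis.FunctionSpaces

/-- The plane. -/
local notation "E2" => EuclideanSpace ℝ (Fin 2)

/-! ### Clusters of the bond graph are finite; the point of maximal norm -/

/-- Connectedness in `(X, K_n^{X,ε})` is symmetric. [folklore] -/
theorem epsConnected_symm {ε : ℝ} {n : ℕ} {X : PointConfig E2} {x y : E2}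
    (h : epsConnected ε n X x y) : epsConnected ε n X y x := by
  induction h with
  | refl => exact Relation.ReflTransGen.refl
  | tail _ hbc ih => exact Relation.ReflTransGen.head ⟨hbc.2.1, hbc.1, epsBond_symm hbc.2.2⟩ ih

/-- Connectedness in `(X, K_n^{X,ε})` is transitive. [folklore] -/
theorem epsConnected_trans {ε : ℝ} {n : ℕ} {X : PointConfig E2} {x y w : E2}
    (h₁ : epsConnected ε n X x y) (h₂ : epsConnected ε n X y w) : epsConnected ε n X x w :=
  Relation.ReflTransGen.trans h₁ h₂

/-- A single bond connects. [folklore] -/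
theorem epsConnected_of_epsBond {ε : ℝ} {n : ℕ} {X : PointConfig E2} {x y : E2} (hx : x ∈ X)
    (hy : y ∈ X) (h : epsBond ε n x y) : epsConnected ε n X x y :=
  Relation.ReflTransGen.single ⟨hx, hy, h⟩

/-- Points connected to a point are that point or points of `X`. [folklore] -/
theorem epsConnected.eq_or_mem {ε : ℝ} {n : ℕ} {X : PointConfig E2} {x y : E2}
    (h : epsConnected ε n X x y) : y = x ∨ y ∈ X := by
  induction h with
  | refl => exact Or.inl rfl
  | tail _ hb _ => exact Or.inr hb.2.1

/-- Points connected to a point of `X` are points of `X`. [folklore] -/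
theorem epsConnected.mem {ε : ℝ} {n : ℕ} {X : PointConfig E2} {x y : E2}
    (h : epsConnected ε n X x y) (hx : x ∈ X) : y ∈ X := by
  rcases h.eq_or_mem with rfl | hy
  · exact hx
  · exact hy

/-- **The cluster of a point is bounded**: a point connected to `x` is `x` itself or has maximum
norm `< n + c_K` (every bond meets `Λ_n` and has Euclidean length `< 1 + ε = c_K`).
[cite: Richthammer2007, §5.2 (p. 11, "`K_n^{X,ε}` is finite as `X` is locally finite and `K_ε` is bounded")] -/
theorem epsConnected.eq_or_supNorm_lt {ε : ℝ} {n : ℕ} {X : PointConfig E2} {x y : E2}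
    (h : epsConnected ε n X x y) : y = x ∨ (y ∈ X ∧ supNorm y < n + (1 + ε)) := by
  induction h with
  | refl => exact Or.inl rfl
  | @tail b c _ hbc _ =>
    obtain ⟨_, hc, _, hbox, hd⟩ := hbc
    right
    refine ⟨hc, ?_⟩
    have hε : 0 < 1 + ε := lt_of_le_of_lt dist_nonneg hd
    rcases hbox with hb' | hc'
    · have h1 : supNorm b ≤ n := supNorm_le_of_mem_box (Nat.cast_nonneg n) hb'
      have h2 : supNorm (c - b) < 1 + ε := by
        refine lt_of_le_of_lt (supNorm_le_norm _) ?_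
        rwa [← dist_eq_norm, dist_comm]
      have h3 := supNorm_sub_le c b
      linarith
    · have h1 : supNorm c ≤ n := supNorm_le_of_mem_box (Nat.cast_nonneg n) hc'
      linarith

/-- **The cluster `C_{X,K_n^{X,ε}}({x})` of a single point.** [cite: Richthammer2007, §3.1 (p. 5)] -/
def clusterOf (ε : ℝ) (n : ℕ) (X : PointConfig E2) (x : E2) : Set E2 := {y | epsConnected ε n X x y}

/-- Membership in the cluster of a point. [folklore] -/
theorem mem_clusterOf {ε : ℝ} {n : ℕ} {X : PointConfig E2} {x y : E2} :
    y ∈ clusterOf ε n X x ↔ epsConnected ε n X x y := Iff.rfl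

/-- A point lies in its own cluster. [folklore] -/
theorem mem_clusterOf_self (ε : ℝ) (n : ℕ) (X : PointConfig E2) (x : E2) : x ∈ clusterOf ε n X x :=
  Relation.ReflTransGen.refl

/-- The cluster of a point lies in `{x} ∪ (X ∩ Λ_{n + c_K})`. [cite: Richthammer2007, §5.2 (p. 11)] -/
theorem clusterOf_subset (ε : ℝ) (n : ℕ) (X : PointConfig E2) (x : E2) :
    clusterOf ε n X x ⊆ insert x ((X : Set E2) ∩ box ((n : ℝ) + (1 + ε))) := by
  intro y hy
  rcases (mem_clusterOf.1 hy).eq_or_supNorm_lt with rfl | ⟨hyX, hlt⟩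
  · exact mem_insert _ _
  · exact mem_insert_of_mem _ ⟨hyX, mem_box_of_supNorm_lt hlt⟩

/-- **Clusters of single points are finite** (`X` is locally finite and the cluster is bounded).
[cite: Richthammer2007, §5.2 (p. 11)] -/
theorem finite_clusterOf (ε : ℝ) (n : ℕ) (X : PointConfig E2) (x : E2) : (clusterOf ε n X x).Finite := by
  have hfin : (insert x ((X : Set E2) ∩ closure (box ((n : ℝ) + (1 + ε))))).Finite :=
    (X.finite_inter_isCompact _ (isBounded_box _).isCompact_closure).insert x
  refine hfin.subset fun y hy => ?_
  rcases clusterOf_subset ε n X x hy with h | h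
  · exact Or.inl h
  · exact Or.inr ⟨h.1, subset_closure h.2⟩

/-- There is a point of maximal maximum norm in the cluster of `x`. [cite: Richthammer2007, §5.2 (p. 11, definition of `a_{n,X}(x)`)] -/
theorem exists_apex (ε : ℝ) (n : ℕ) (X : PointConfig E2) (x : E2) :
    ∃ a ∈ clusterOf ε n X x, ∀ y ∈ clusterOf ε n X x, supNorm y ≤ supNorm a :=
  Set.exists_max_image _ supNorm (finite_clusterOf ε n X x) ⟨x, mem_clusterOf_self ε n X x⟩

/-- **`a_{n,X}(x)`**: a point of the cluster of `x` in `(X, K_n^{X,ε})` with maximal maximum norm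
("the point of `C(x)` with maximal `|.|`-distance to the origin"; Richthammer breaks ties
lexicographically, here an arbitrary maximiser is chosen — only `|a_{n,X}(x)|` is ever used).
[cite: Richthammer2007, §5.2 (p. 11)] -/
def apex (ε : ℝ) (n : ℕ) (X : PointConfig E2) (x : E2) : E2 := (exists_apex ε n X x).choose

/-- `a_{n,X}(x)` lies in the cluster of `x`. [cite: Richthammer2007, §5.2 (p. 11)] -/
theorem epsConnected_apex (ε : ℝ) (n : ℕ) (X : PointConfig E2) (x : E2) :
    epsConnected ε n X x (apex ε n X x) :=
  (exists_apex ε n X x).choose_spec.1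

/-- **`τ_n(|a_{n,X}(x)|) = min{τ_n(|x'|) : x' ∈ C(x)}`, norm form**: every point of the cluster of
`x` has maximum norm at most `|a_{n,X}(x)|`. [cite: Richthammer2007, §5.2 (p. 11)] -/
theorem supNorm_le_supNorm_apex {ε : ℝ} {n : ℕ} {X : PointConfig E2} {x y : E2}
    (h : epsConnected ε n X x y) : supNorm y ≤ supNorm (apex ε n X x) :=
  (exists_apex ε n X x).choose_spec.2 y h

/-- `|a_{n,X}(x)| ≥ |x|`. [cite: Richthammer2007, §5.2 (p. 11)] -/
theorem supNorm_le_supNorm_apex_self (ε : ℝ) (n : ℕ) (X : PointConfig E2) (x : E2) :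
    supNorm x ≤ supNorm (apex ε n X x) :=
  supNorm_le_supNorm_apex (mem_clusterOf_self ε n X x)

/-- Connected points have the same `|a_{n,X}|` ("`a_{n,X}(P^i) = a_{n,X}(P^k)` for
`P^k - P^i ∈ K_ε`", proof of (6.9)). [cite: Richthammer2007, §6.4 (p. 15)] -/
theorem supNorm_apex_eq {ε : ℝ} {n : ℕ} {X : PointConfig E2} {x x' : E2}
    (h : epsConnected ε n X x x') : supNorm (apex ε n X x) = supNorm (apex ε n X x') :=
  le_antisymm
    (supNorm_le_supNorm_apex (epsConnected_trans (epsConnected_symm h) (epsConnected_apex ε n X x)))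
    (supNorm_le_supNorm_apex (epsConnected_trans h (epsConnected_apex ε n X x')))

/-- `a_{n,X}(x) ∈ X` for `x ∈ X`. [folklore] -/
theorem apex_mem {ε : ℝ} {n : ℕ} {X : PointConfig E2} {x : E2} (hx : x ∈ X) : apex ε n X x ∈ X :=
  (epsConnected_apex ε n X x).mem hx

/-- For a point outside `Λ_n`, `|a_{n,X}(x)| ≥ |x| ≥ n`, so `τ_n(|a_{n,X}(x)|) = 0`. [cite: Richthammer2007, §6.4 (p. 15)] -/
theorem le_supNorm_apex_of_notMem_box {ε : ℝ} {n : ℕ} {X : PointConfig E2} {x : E2}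
    (hx : x ∉ box (n : ℝ)) : (n : ℝ) ≤ supNorm (apex ε n X x) :=
  (le_supNorm_of_notMem_box hx).trans (supNorm_le_supNorm_apex_self ε n X x)

/-! ### The measurable majorants and the good set -/

/-- **The path-expansion majorant of the cluster range `r_{n,X}(Λ_{n'})`** (proof of Lemma 7,
§6.1): `n' + ∑_m ∑≠_{x₀,…,x_m ∈ X} m c_K 1{x₀ ∈ Λ_{n'}} ∏ 1_{K_ε∖K}(x_i - x_{i-1})`; it does not
depend on `n` and dominates `r_{n,X}(Λ_{n'})` on hard-disc configurations
(`clusterRange_le_pathSum`). [cite: Richthammer2007, §6.1 (p. 13)] -/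
def rangeSum (ε : ℝ) (n' : ℕ) (X : PointConfig E2) : ℝ≥0∞ :=
  (n' : ℝ≥0∞) + ∑' m : ℕ, ∑' x : {x : Fin (m + 1) → E2 // Function.Injective x ∧ ∀ i, x i ∈ X},
    ENNReal.ofReal (m * (1 + ε)) * pathFun ((box (n' : ℝ)).indicator 1) ε m x.1

/-- The range majorant is measurable. [folklore] -/
theorem measurable_rangeSum (ε : ℝ) (n' : ℕ) : Measurable (rangeSum ε n') := by
  unfold rangeSum
  refine Measurable.const_add (Measurable.tsum fun m => ?_) _
  exact measurable_tsum_injective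
    ((measurable_pathFun (measurable_one.indicator (measurableSet_box _)) ε m).const_mul _)

/-- **`Σ₁ + Σ₂ + Σ₃` with Richthammer's constants**: `4c_f² Σ₁ + (2τ²/Q(n-R)²) Σ₂ + 2c_f² Σ₃` in
terms of the tree's constant-free `sigma₁`, `sigma₂`, `sigma₃`.
[cite: Richthammer2007, §5.3 (5.3'), §6.4 (6.7'), §6.7 (6.14) (pp. 11, 15, 17)] -/
def sigmaTotal (τ R : ℝ) (n : ℕ) (ε : ℝ) (X : PointConfig E2) : ℝ≥0∞ :=
  ENNReal.ofReal (4 * cF ε ^ 2) * sigma₁ τ R n ε X +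
    ENNReal.ofReal (2 * τ ^ 2 / QFun ((n : ℝ) - R) ^ 2) * sigma₂ R n X +
      ENNReal.ofReal (2 * cF ε ^ 2) * sigma₃ τ R n ε X

/-- **The measurable majorant of `Σ₁ + Σ₂ + Σ₃`** (§6.8): the same combination of the path sums
`pathSum₁`, `pathSum₃`, `pathSum₁'` with head weight `1_{Λ_n̄} q(|·| - R̄)²` and the factor
`τ²c_K²/Q(n-R)²`. [cite: Richthammer2007, §6.8 (pp. 17–18)] -/
def sigmaSum (τ R : ℝ) (n : ℕ) (ε : ℝ) (X : PointConfig E2) : ℝ≥0∞ :=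
  ENNReal.ofReal (4 * cF ε ^ 2) *
      (ENNReal.ofReal (τ ^ 2 * (1 + ε) ^ 2 / QFun ((n : ℝ) - R) ^ 2) *
        pathSum₁ (headWeight (R + (1 + ε)) ((n : ℝ) + (1 + ε))) ε X) +
    ENNReal.ofReal (2 * τ ^ 2 / QFun ((n : ℝ) - R) ^ 2) *
        pathSum₁ (headWeight (R + (1 + ε)) ((n : ℝ) + (1 + ε))) ε X +
      ENNReal.ofReal (2 * cF ε ^ 2) *
        (ENNReal.ofReal (τ ^ 2 * (1 + ε) ^ 2 / QFun ((n : ℝ) - R) ^ 2) *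
          (pathSum₃ (headWeight (R + (1 + ε)) ((n : ℝ) + (1 + ε))) ε X +
            pathSum₁' (headWeight (R + (1 + ε)) ((n : ℝ) + (1 + ε))) ε X))

/-- The majorant of `Σ₁ + Σ₂ + Σ₃` is measurable. [folklore] -/
theorem measurable_sigmaSum (τ R : ℝ) (n : ℕ) (ε : ℝ) : Measurable (sigmaSum τ R n ε) := by
  have hw := measurable_headWeight (R + (1 + ε)) ((n : ℝ) + (1 + ε))
  unfold sigmaSum
  refine ((Measurable.const_mul ((measurable_pathSum₁ hw ε).const_mul _) _).add
    ((measurable_pathSum₁ hw ε).const_mul _)).add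
      (Measurable.const_mul (((measurable_pathSum₃ hw ε).add (measurable_pathSum₁' hw ε)).const_mul _) _)

/-- **On hard-disc configurations the majorant dominates `4c_f² Σ₁ + (2τ²/Q²) Σ₂ + 2c_f² Σ₃`**
(the three path expansions of §6.8). [cite: Richthammer2007, §6.8 (p. 18)] -/
theorem sigmaTotal_le_sigmaSum {τ R ε : ℝ} {n : ℕ} (hτ : 0 ≤ τ) (hRn : R < n) (hε : 0 < ε)
    {X : PointConfig E2} (hX : IsHardCore X) : sigmaTotal τ R n ε X ≤ sigmaSum τ R n ε X := by
  unfold sigmaTotal sigmaSum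
  gcongr
  · exact sigma₁_le_pathSum₁ hτ hRn hε hX
  · exact sigma₂_le_pathSum₁ hε.le n X
  · exact sigma₃_le_pathSums hτ hRn hε hX

/-- **The good configurations** (a measurable subset of Richthammer's `G_n` of (5.3')): hard-disc
configurations whose range majorant is `< R` (so `r_{n,X}(Λ_{n'}) < R`, i.e. `X ∈ G^a_n`) and
whose majorant of `Σ₁ + Σ₂ + Σ₃` is `< 1`. Parameters: shift `τ`, radius `R`, outer box `n`,
cylinder box `n'`, enlargement `ε`. [cite: Richthammer2007, §5.2 (`G^a_n`) and §5.3 (5.3') (p. 11)] -/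
def goodSet (τ : ℝ) (R : ℕ) (n n' : ℕ) (ε : ℝ) : Set (PointConfig E2) :=
  {X | IsHardCore X ∧ rangeSum ε n' X < R ∧ sigmaSum τ R n ε X < 1}

/-- **`G_n ∈ 𝓕_𝒳`**: the good set is measurable. [cite: Richthammer2007, §5.3 (5.3') (p. 11)] -/
theorem measurableSet_goodSet (τ : ℝ) (R : ℕ) (n n' : ℕ) (ε : ℝ) :
    MeasurableSet (goodSet τ R n n' ε) :=
  measurableSet_isHardCore.inter
    ((measurableSet_lt (measurable_rangeSum ε n') measurable_const).inter
      (measurableSet_lt (measurable_sigmaSum τ R n ε) measurable_const))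

/-! ### What good configurations provide -/

/-- Good configurations are hard-disc configurations. [folklore] -/
theorem isHardCore_of_mem_goodSet {τ : ℝ} {R : ℕ} {n n' : ℕ} {ε : ℝ} {X : PointConfig E2}
    (hX : X ∈ goodSet τ R n n' ε) : IsHardCore X :=
  hX.1

/-- **`X ∈ G^a_n`: the cluster of `Λ_{n'}` lies inside `Λ_R`** — every point connected to a point of
`X ∩ Λ_{n'}` has maximum norm `< R` (`r_{n,X}(Λ_{n'}) < R`).
[cite: Richthammer2007, §5.2 (p. 11, definition of `G^a_n`) and §6.4 (p. 15, "`x ∈ Λ_{n'} ⇒ a_{n,X}(x) ∈ Λ_R`")] -/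
theorem supNorm_lt_of_mem_goodSet {τ : ℝ} {R : ℕ} {n n' : ℕ} {ε : ℝ} (hε : 0 < ε)
    {X : PointConfig E2} (hX : X ∈ goodSet τ R n n' ε) {x y : E2} (hx : x ∈ X)
    (hxb : x ∈ box (n' : ℝ)) (h : epsConnected ε n X x y) : supNorm y < R := by
  have hy : y ∈ cluster ε n X (box n') := ⟨x, hx, hxb, h⟩
  have h1 : ENNReal.ofReal (supNorm y) ≤ clusterRange ε n X (box n') := by
    unfold clusterRange
    exact le_iSup₂ (f := fun y _ => ENNReal.ofReal (supNorm y)) y hy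
  have h2 : clusterRange ε n X (box n') < R :=
    lt_of_le_of_lt (clusterRange_le_pathSum hε n n' hX.1) hX.2.1
  have h3 : ENNReal.ofReal (supNorm y) < ENNReal.ofReal (R : ℝ) := by
    rw [ENNReal.ofReal_natCast]
    exact lt_of_le_of_lt h1 h2
  exact (ENNReal.ofReal_lt_ofReal_iff_of_nonneg (supNorm_nonneg y)).1 h3

/-- For a good configuration the `|a_{n,X}|` of a point of `Λ_{n'}` is `< R`, hence
`τ_n(|a_{n,X}(x)|) = τ`. [cite: Richthammer2007, §6.4 (p. 15)] -/
theorem supNorm_apex_lt_of_mem_goodSet {τ : ℝ} {R : ℕ} {n n' : ℕ} {ε : ℝ} (hε : 0 < ε)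
    {X : PointConfig E2} (hX : X ∈ goodSet τ R n n' ε) {x : E2} (hx : x ∈ X)
    (hxb : x ∈ box (n' : ℝ)) : supNorm (apex ε n X x) < R :=
  supNorm_lt_of_mem_goodSet hε hX hx hxb (epsConnected_apex ε n X x)

/-- **`Σ₁ + Σ₂ + Σ₃ < 1` on good configurations** (with `R < n`, `0 ≤ τ`).
[cite: Richthammer2007, §5.3 (5.3') (p. 11)] -/
theorem sigmaTotal_lt_one {τ : ℝ} {R : ℕ} {n n' : ℕ} {ε : ℝ} (hτ : 0 ≤ τ) (hRn : R < n) (hε : 0 < ε)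
    {X : PointConfig E2} (hX : X ∈ goodSet τ R n n' ε) : sigmaTotal τ R n ε X < 1 :=
  lt_of_le_of_lt (sigmaTotal_le_sigmaSum hτ (by exact_mod_cast hRn) hε hX.1) hX.2.2

/-- A single summand of `Σ₁` on a good configuration: `4 c_f² T_n(x, x') < 1` for connected
`x, x' ∈ X`. [cite: Richthammer2007, §6.4 (p. 15, "every summand of `Σ₁` is less than `1`")] -/
theorem four_mul_cF_sq_mul_tDistSq_lt_one {τ : ℝ} {R : ℕ} {n n' : ℕ} {ε : ℝ} (hτ : 0 ≤ τ)
    (hRn : R < n) (hε : 0 < ε) {X : PointConfig E2} (hX : X ∈ goodSet τ R n n' ε) {x y : E2}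
    (hx : x ∈ X) (hy : y ∈ X) (h : epsConnected ε n X x y) :
    4 * cF ε ^ 2 * tDistSq τ R n ε x y < 1 := by
  have htot := sigmaTotal_lt_one hτ hRn hε hX
  have h1 : ENNReal.ofReal (4 * cF ε ^ 2) * ENNReal.ofReal (tDistSq τ R n ε x y) < 1 := by
    refine lt_of_le_of_lt ?_ htot
    unfold sigmaTotal
    refine le_trans ?_ (le_trans le_self_add le_self_add)
    refine mul_le_mul' le_rfl ?_
    unfold sigma₁
    exact ENNReal.le_tsum (⟨(x, y), hx, hy, h⟩ :
      {p : E2 × E2 // p.1 ∈ X ∧ p.2 ∈ X ∧ epsConnected ε n X p.1 p.2})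
  have h2 : ENNReal.ofReal (4 * cF ε ^ 2 * tDistSq τ R n ε x y) < ENNReal.ofReal 1 := by
    rw [ENNReal.ofReal_mul (by positivity : (0 : ℝ) ≤ 4 * cF ε ^ 2), ENNReal.ofReal_one]
    exact h1
  exact (ENNReal.ofReal_lt_ofReal_iff_of_nonneg
    (mul_nonneg (by positivity) (tDistSq_nonneg _ _ _ _ _ _))).1 h2

/-- **(6.7) on good configurations**: for `x, x' ∈ X` connected in `(X, K_n^{X,ε})` with
`|x| ≤ |x'|`, `(τ_n(|x| - c_K) - τ_n(|x'|)) c_f < 1/2`. [cite: Richthammer2007, §6.4 (6.7) (p. 15)] -/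
theorem profile_gap_lt_half {τ : ℝ} {R : ℕ} {n n' : ℕ} {ε : ℝ} (hτ : 0 ≤ τ) (hRn : R < n) (hε : 0 < ε)
    {X : PointConfig E2} (hX : X ∈ goodSet τ R n n' ε) {x y : E2} (hx : x ∈ X) (hy : y ∈ X)
    (h : epsConnected ε n X x y) (hle : supNorm x ≤ supNorm y) :
    (tProfile τ R n (supNorm x - (1 + ε)) - tProfile τ R n (supNorm y)) * cF ε < 1 / 2 := by
  have h4 := four_mul_cF_sq_mul_tDistSq_lt_one hτ hRn hε hX hx hy h
  unfold tDistSq at h4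
  rw [if_pos hle] at h4
  set d := tProfile τ R n (supNorm x - (1 + ε)) - tProfile τ R n (supNorm y)
  have hsq : (2 * (d * cF ε)) ^ 2 < 1 := by nlinarith
  have habs : |2 * (d * cF ε)| < 1 := by
    rw [← abs_one]
    exact sq_lt_sq.1 (by simpa using hsq)
  have := (abs_lt.1 habs).2
  linarith

/-- The gap in (6.7) is nonnegative: `τ_n(|x| - c_K) ≥ τ_n(|x|) ≥ τ_n(|x'|)` for `|x| ≤ |x'|`
(`τ_n` decreasing, `ε ≥ 0`, `R < n`). [cite: Richthammer2007, §5.2 (5.2) (p. 11)] -/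
theorem profile_gap_nonneg {τ R ε : ℝ} {n : ℕ} (hτ : 0 ≤ τ) (hRn : R < n) (hε : 0 ≤ ε) {x y : E2}
    (hle : supNorm x ≤ supNorm y) :
    0 ≤ tProfile τ R n (supNorm x - (1 + ε)) - tProfile τ R n (supNorm y) :=
  sub_nonneg.2 (tProfile_antitone hτ hRn (by linarith))

/-! ### Expectations: the range majorant (§6.1) -/

/-- **The `n`-independent bound of §6.1**: `∫ μ(dX) rangeSum ≤ n' + ∑_m z^{m+1} λ²(Λ_{n'}) m c_K c_ε^m`
(Lemma 3 termwise, translation invariance of Lebesgue measure). [cite: Richthammer2007, §6.1 (p. 13)] -/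
theorem lintegral_rangeSum_le {z : ℝ} (hz : 0 < z) {μ : Measure (PointConfig E2)} (hμ : IsGibbs z μ)
    (ε : ℝ) (n' : ℕ) :
    ∫⁻ X, rangeSum ε n' X ∂μ ≤ (n' : ℝ≥0∞) + ∑' m : ℕ, ENNReal.ofReal z ^ (m + 1) *
      (volume (box (n' : ℝ)) * ENNReal.ofReal (m * (1 + ε)) * volume (annulus ε) ^ m) := by
  haveI := hμ.1
  have hwm : Measurable ((box (n' : ℝ)).indicator (1 : E2 → ℝ≥0∞)) :=
    measurable_one.indicator (measurableSet_box _)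
  have hFm : ∀ m : ℕ, Measurable fun x : Fin (m + 1) → E2 =>
      ENNReal.ofReal (m * (1 + ε)) * pathFun ((box (n' : ℝ)).indicator 1) ε m x :=
    fun m => (measurable_pathFun hwm ε m).const_mul _
  unfold rangeSum
  rw [lintegral_add_left measurable_const, lintegral_const, measure_univ, mul_one,
    lintegral_tsum fun m => (measurable_tsum_injective (hFm m)).aemeasurable]
  refine add_le_add le_rfl (ENNReal.tsum_le_tsum fun m => ?_)
  have hvol : ∫⁻ x, ENNReal.ofReal (m * (1 + ε)) * pathFun ((box (n' : ℝ)).indicator 1) ε m x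
      ∂(Measure.pi fun _ : Fin (m + 1) => (volume : Measure E2)) =
      volume (box (n' : ℝ)) * ENNReal.ofReal (m * (1 + ε)) * volume (annulus ε) ^ m := by
    rw [lintegral_const_mul _ (measurable_pathFun hwm ε m), lintegral_pathFun hwm ε m,
      lintegral_indicator_one (measurableSet_box _)]
    ring
  rw [← hvol]
  exact Richthammer2007_lemma3_holds z hz μ hμ (m + 1) _ (hFm m)

/-- The bound of §6.1 is finite when `z c_ε < 1` ("the last sum is finite because `c_ε z ξ < 1`").
[cite: Richthammer2007, §6.1 (p. 13)] -/
theorem rangeBound_lt_top {z ε : ℝ}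
    (hsmall : ENNReal.ofReal z * volume (Metric.ball (0 : E2) (1 + ε) \ Metric.closedBall 0 1) < 1)
    (n' : ℕ) :
    (n' : ℝ≥0∞) + ∑' m : ℕ, ENNReal.ofReal z ^ (m + 1) *
      (volume (box (n' : ℝ)) * ENNReal.ofReal (m * (1 + ε)) * volume (annulus ε) ^ m) < ⊤ := by
  rw [← annulus_eq] at hsmall
  have hterm : ∀ m : ℕ, ENNReal.ofReal z ^ (m + 1) *
      (volume (box (n' : ℝ)) * ENNReal.ofReal (m * (1 + ε)) * volume (annulus ε) ^ m) =
      (ENNReal.ofReal z * volume (box (n' : ℝ)) * ENNReal.ofReal (1 + ε)) *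
        ((m : ℝ≥0∞) * (ENNReal.ofReal z * volume (annulus ε)) ^ m) := by
    intro m
    rw [ENNReal.ofReal_mul (Nat.cast_nonneg m), ENNReal.ofReal_natCast]
    ring
  simp_rw [hterm]
  rw [ENNReal.tsum_mul_left]
  refine ENNReal.add_lt_top.2 ⟨ENNReal.natCast_lt_top n', ?_⟩
  refine ENNReal.mul_lt_top ?_ (tsum_natCast_mul_pow_lt_top hsmall)
  refine ENNReal.mul_lt_top (ENNReal.mul_lt_top ENNReal.ofReal_lt_top ?_) ENNReal.ofReal_lt_top
  exact (isBounded_box (n' : ℝ)).measure_lt_top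

/-- **The choice of `R`** (§5.2: "By the Chebyshev inequality we therefore can choose an integer
`R > n'`, such that for every `n > n'` we have `μ(G^a_n) ≥ 1 - δ/2`"): for every `δ > 0` there is
an integer `R > n'` with `μ(rangeSum ≥ R) ≤ δ/2` (Markov's inequality; the range majorant does not
depend on `n`). [cite: Richthammer2007, §5.2 (p. 11)] -/
theorem exists_radius {z : ℝ} (hz : 0 < z) {μ : Measure (PointConfig E2)} (hμ : IsGibbs z μ) {ε : ℝ}
    (hsmall : ENNReal.ofReal z * volume (Metric.ball (0 : E2) (1 + ε) \ Metric.closedBall 0 1) < 1)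
    (n' : ℕ) {δ : ℝ} (hδ : 0 < δ) :
    ∃ R : ℕ, n' < R ∧ μ {X | (R : ℝ≥0∞) ≤ rangeSum ε n' X} ≤ ENNReal.ofReal (δ / 2) := by
  set M : ℝ≥0∞ := (n' : ℝ≥0∞) + ∑' m : ℕ, ENNReal.ofReal z ^ (m + 1) *
    (volume (box (n' : ℝ)) * ENNReal.ofReal (m * (1 + ε)) * volume (annulus ε) ^ m) with hM
  have hMtop : M ≠ ⊤ := (rangeBound_lt_top hsmall n').ne
  have hint : ∫⁻ X, rangeSum ε n' X ∂μ ≤ M := lintegral_rangeSum_le hz hμ ε n'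
  -- `R > n'` with `M ≤ (δ/2) R`
  obtain ⟨R, hRn', hRM⟩ : ∃ R : ℕ, n' < R ∧ M.toReal ≤ δ / 2 * R := by
    refine ⟨max (n' + 1) ⌈M.toReal / (δ / 2)⌉₊, ?_, ?_⟩
    · exact lt_of_lt_of_le (Nat.lt_succ_self n') (le_max_left _ _)
    · have h1 : M.toReal / (δ / 2) ≤ ⌈M.toReal / (δ / 2)⌉₊ := Nat.le_ceil _
      have h2 : (⌈M.toReal / (δ / 2)⌉₊ : ℝ) ≤ ((max (n' + 1) ⌈M.toReal / (δ / 2)⌉₊ : ℕ) : ℝ) := by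
        exact_mod_cast le_max_right _ _
      have hδ2 : 0 < δ / 2 := by positivity
      calc M.toReal = M.toReal / (δ / 2) * (δ / 2) := by field_simp
        _ ≤ ((max (n' + 1) ⌈M.toReal / (δ / 2)⌉₊ : ℕ) : ℝ) * (δ / 2) :=
            mul_le_mul_of_nonneg_right (h1.trans h2) hδ2.le
        _ = _ := by ring
  refine ⟨R, hRn', ?_⟩
  have hR0 : (R : ℝ≥0∞) ≠ 0 := by
    have : 0 < R := lt_of_le_of_lt (Nat.zero_le n') hRn'
    exact_mod_cast this.ne'
  calc μ {X | (R : ℝ≥0∞) ≤ rangeSum ε n' X}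
      ≤ (∫⁻ X, rangeSum ε n' X ∂μ) / R :=
        meas_ge_le_lintegral_div (measurable_rangeSum ε n').aemeasurable hR0 (ENNReal.natCast_ne_top R)
    _ ≤ M / R := ENNReal.div_le_div_right hint _
    _ ≤ ENNReal.ofReal (δ / 2) := by
        refine ENNReal.div_le_of_le_mul ?_
        rw [← ENNReal.ofReal_toReal hMtop, ← ENNReal.ofReal_natCast, ← ENNReal.ofReal_mul (by positivity)]
        exact ENNReal.ofReal_le_ofReal hRM

/-! ### Expectations: the majorant of `Σ₁ + Σ₂ + Σ₃` (§6.8) -/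

/-- **The expectation of the majorant of `Σ₁ + Σ₂ + Σ₃` is `O(c(n))`**: there is a finite `K`
(depending on `z, τ, ε` only) with `∫ μ(dX) sigmaSum ≤ K c(n̄)` for all `n > R`
(`c(n̄) = Q(n̄ - R̄)⁻² ∫_{Λ_n̄} q(|x| - R̄)²`, the tree's `cFun`). [cite: Richthammer2007, §6.8 (p. 18)] -/
theorem exists_lintegral_sigmaSum_le {z : ℝ} (hz : 0 < z) {μ : Measure (PointConfig E2)}
    (hμ : IsGibbs z μ) (τ : ℝ) {ε : ℝ} (hε : 0 < ε)
    (hsmall : ENNReal.ofReal z * volume (Metric.ball (0 : E2) (1 + ε) \ Metric.closedBall 0 1) < 1)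
    (R : ℝ) :
    ∃ K : ℝ≥0∞, K ≠ ⊤ ∧ ∀ n : ℕ, R < n →
      ∫⁻ X, sigmaSum τ R n ε X ∂μ ≤ K * cFun (R + (1 + ε)) ((n : ℝ) + (1 + ε)) := by
  rw [← annulus_eq] at hsmall
  -- the finite series of §6.8
  set S₂ : ℝ≥0∞ := ∑' m : ℕ, ((m : ℝ≥0∞) + 1) ^ 2 * (ENNReal.ofReal z * volume (annulus ε)) ^ m with hS₂
  set S₃ : ℝ≥0∞ := ∑' m : ℕ, ((m : ℝ≥0∞) + 1) ^ 2 * (m : ℝ≥0∞) * (ENNReal.ofReal z * volume (annulus ε)) ^ m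
    with hS₃
  have hS₂top : S₂ ≠ ⊤ := (tsum_sq_mul_pow_lt_top hsmall).ne
  have hS₃top : S₃ ≠ ⊤ := (tsum_sq_mul_mul_pow_lt_top hsmall).ne
  have hvol : volume (annulus ε) ≠ ⊤ :=
    (lt_of_le_of_lt (measure_mono (by rw [annulus_eq]; exact fun v hv => hv.1)) measure_ball_lt_top).ne
  -- the constant
  set A : ℝ≥0∞ := ENNReal.ofReal (τ ^ 2 * (1 + ε) ^ 2) with hA
  set K : ℝ≥0∞ := ENNReal.ofReal (4 * cF ε ^ 2) * (A * (ENNReal.ofReal z * S₂)) +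
    ENNReal.ofReal (2 * τ ^ 2) * (ENNReal.ofReal z * S₂) +
      ENNReal.ofReal (2 * cF ε ^ 2) * (A * (ENNReal.ofReal z *
        (ENNReal.ofReal z * volume (annulus ε) * S₂ + S₃))) with hK
  have hKtop : K ≠ ⊤ := by
    rw [hK]
    refine ENNReal.add_ne_top.2 ⟨ENNReal.add_ne_top.2 ⟨?_, ?_⟩, ?_⟩
    · exact ENNReal.mul_ne_top ENNReal.ofReal_ne_top
        (ENNReal.mul_ne_top ENNReal.ofReal_ne_top (ENNReal.mul_ne_top ENNReal.ofReal_ne_top hS₂top))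
    · exact ENNReal.mul_ne_top ENNReal.ofReal_ne_top (ENNReal.mul_ne_top ENNReal.ofReal_ne_top hS₂top)
    · refine ENNReal.mul_ne_top ENNReal.ofReal_ne_top
        (ENNReal.mul_ne_top ENNReal.ofReal_ne_top (ENNReal.mul_ne_top ENNReal.ofReal_ne_top ?_))
      exact ENNReal.add_ne_top.2
        ⟨ENNReal.mul_ne_top (ENNReal.mul_ne_top ENNReal.ofReal_ne_top hvol) hS₂top, hS₃top⟩
  refine ⟨K, hKtop, fun n hRn => ?_⟩
  have hw := measurable_headWeight (R + (1 + ε)) ((n : ℝ) + (1 + ε))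
  set w := headWeight (R + (1 + ε)) ((n : ℝ) + (1 + ε)) with hwdef
  set I : ℝ≥0∞ := ∫⁻ b, w b ∂volume with hI
  -- `c(n̄)` and the factor `C = A / Q²`
  have hcFun : cFun (R + (1 + ε)) ((n : ℝ) + (1 + ε)) = ENNReal.ofReal (1 / QFun ((n : ℝ) - R) ^ 2) * I := by
    unfold cFun
    have e : (n : ℝ) + (1 + ε) - (R + (1 + ε)) = (n : ℝ) - R := by ring
    rw [e, hI, hwdef, lintegral_headWeight]
  have hC : ENNReal.ofReal (τ ^ 2 * (1 + ε) ^ 2 / QFun ((n : ℝ) - R) ^ 2) =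
      A * ENNReal.ofReal (1 / QFun ((n : ℝ) - R) ^ 2) := by
    rw [hA, ← ENNReal.ofReal_mul (by positivity)]
    congr 1
    ring
  have hC₂ : ENNReal.ofReal (2 * τ ^ 2 / QFun ((n : ℝ) - R) ^ 2) =
      ENNReal.ofReal (2 * τ ^ 2) * ENNReal.ofReal (1 / QFun ((n : ℝ) - R) ^ 2) := by
    rw [← ENNReal.ofReal_mul (by positivity)]
    congr 1
    ring
  -- the three expectations
  have h₁ : ∫⁻ X, pathSum₁ w ε X ∂μ ≤ ENNReal.ofReal z * I * S₂ := lintegral_pathSum₁_le hz hμ hw ε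
  have h₃ : ∫⁻ X, pathSum₃ w ε X ∂μ ≤ ENNReal.ofReal z * I * (ENNReal.ofReal z * volume (annulus ε)) * S₂ :=
    lintegral_pathSum₃_le hz hμ hw ε
  have h₁' : ∫⁻ X, pathSum₁' w ε X ∂μ ≤ ENNReal.ofReal z * I * S₃ := lintegral_pathSum₁'_le hz hμ hw ε
  -- integrate the majorant
  have hm₁ : Measurable fun X => pathSum₁ w ε X := measurable_pathSum₁ hw ε
  have hm₃ : Measurable fun X => pathSum₃ w ε X + pathSum₁' w ε X :=
    (measurable_pathSum₃ hw ε).add (measurable_pathSum₁' hw ε)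
  have hsplit : ∫⁻ X, sigmaSum τ R n ε X ∂μ =
      ENNReal.ofReal (4 * cF ε ^ 2) * (ENNReal.ofReal (τ ^ 2 * (1 + ε) ^ 2 / QFun ((n : ℝ) - R) ^ 2) *
        ∫⁻ X, pathSum₁ w ε X ∂μ) +
      ENNReal.ofReal (2 * τ ^ 2 / QFun ((n : ℝ) - R) ^ 2) * ∫⁻ X, pathSum₁ w ε X ∂μ +
        ENNReal.ofReal (2 * cF ε ^ 2) * (ENNReal.ofReal (τ ^ 2 * (1 + ε) ^ 2 / QFun ((n : ℝ) - R) ^ 2) *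
          (∫⁻ X, pathSum₃ w ε X ∂μ + ∫⁻ X, pathSum₁' w ε X ∂μ)) := by
    unfold sigmaSum
    rw [← hwdef]
    rw [lintegral_add_right _ ((hm₃.const_mul _).const_mul _),
      lintegral_add_right _ (hm₁.const_mul _),
      lintegral_const_mul _ (hm₁.const_mul _), lintegral_const_mul _ hm₁,
      lintegral_const_mul _ hm₁,
      lintegral_const_mul _ (hm₃.const_mul _), lintegral_const_mul _ hm₃,
      lintegral_add_left (measurable_pathSum₃ hw ε)]
  rw [hsplit, hC, hC₂, hcFun, hK]
  -- compare term by term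
  have hQI : ∀ a b : ℝ≥0∞, a ≤ b →
      ENNReal.ofReal (1 / QFun ((n : ℝ) - R) ^ 2) * a ≤ ENNReal.ofReal (1 / QFun ((n : ℝ) - R) ^ 2) * b :=
    fun a b hab => mul_le_mul' le_rfl hab
  calc ENNReal.ofReal (4 * cF ε ^ 2) * (A * ENNReal.ofReal (1 / QFun ((n : ℝ) - R) ^ 2) *
          ∫⁻ X, pathSum₁ w ε X ∂μ) +
        ENNReal.ofReal (2 * τ ^ 2) * ENNReal.ofReal (1 / QFun ((n : ℝ) - R) ^ 2) * ∫⁻ X, pathSum₁ w ε X ∂μ +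
          ENNReal.ofReal (2 * cF ε ^ 2) * (A * ENNReal.ofReal (1 / QFun ((n : ℝ) - R) ^ 2) *
            (∫⁻ X, pathSum₃ w ε X ∂μ + ∫⁻ X, pathSum₁' w ε X ∂μ))
      ≤ ENNReal.ofReal (4 * cF ε ^ 2) * (A * ENNReal.ofReal (1 / QFun ((n : ℝ) - R) ^ 2) *
          (ENNReal.ofReal z * I * S₂)) +
        ENNReal.ofReal (2 * τ ^ 2) * ENNReal.ofReal (1 / QFun ((n : ℝ) - R) ^ 2) * (ENNReal.ofReal z * I * S₂) +
          ENNReal.ofReal (2 * cF ε ^ 2) * (A * ENNReal.ofReal (1 / QFun ((n : ℝ) - R) ^ 2) *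
            (ENNReal.ofReal z * I * (ENNReal.ofReal z * volume (annulus ε)) * S₂ + ENNReal.ofReal z * I * S₃)) := by
        gcongr
    _ = (ENNReal.ofReal (4 * cF ε ^ 2) * (A * (ENNReal.ofReal z * S₂)) +
          ENNReal.ofReal (2 * τ ^ 2) * (ENNReal.ofReal z * S₂) +
            ENNReal.ofReal (2 * cF ε ^ 2) * (A * (ENNReal.ofReal z *
              (ENNReal.ofReal z * volume (annulus ε) * S₂ + S₃)))) *
          (ENNReal.ofReal (1 / QFun ((n : ℝ) - R) ^ 2) * I) := by
        ring

/-- **The expectation of the majorant of `Σ₁ + Σ₂ + Σ₃` tends to `0`** as `n → ∞` ("the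
expectation of every `Σ_i` can be made arbitrarily small when `n` is chosen big enough", §6.8,
via `lim c(n) = 0`, (6.17)). [cite: Richthammer2007, §6.8 (pp. 17–18)] -/
theorem tendsto_lintegral_sigmaSum {z : ℝ} (hz : 0 < z) {μ : Measure (PointConfig E2)}
    (hμ : IsGibbs z μ) (τ : ℝ) {ε : ℝ} (hε : 0 < ε)
    (hsmall : ENNReal.ofReal z * volume (Metric.ball (0 : E2) (1 + ε) \ Metric.closedBall 0 1) < 1)
    (R : ℝ) :
    Tendsto (fun n : ℕ => ∫⁻ X, sigmaSum τ R n ε X ∂μ) atTop (𝓝 0) := by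
  obtain ⟨K, hKtop, hK⟩ := exists_lintegral_sigmaSum_le hz hμ τ hε hsmall R
  have hc : Tendsto (fun n : ℕ => cFun (R + (1 + ε)) ((n : ℝ) + (1 + ε))) atTop (𝓝 0) :=
    (tendsto_cFun_zero (R + (1 + ε))).comp (tendsto_atTop_add_const_right _ _ tendsto_natCast_atTop_atTop)
  have hKc : Tendsto (fun n : ℕ => K * cFun (R + (1 + ε)) ((n : ℝ) + (1 + ε))) atTop (𝓝 0) := by
    have := ENNReal.Tendsto.const_mul hc (Or.inr hKtop)
    simpa using this
  refine tendsto_of_tendsto_of_tendsto_of_le_of_le' tendsto_const_nhds hKc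
    (Eventually.of_forall fun n => zero_le) ?_
  filter_upwards [eventually_gt_atTop ⌈R⌉₊] with n hn
  exact hK n (lt_of_le_of_lt (Nat.le_ceil R) (by exact_mod_cast hn))

/-! ### Lemma 13 -/

/-- **The bad set is controlled by the two majorants**:
`μ(G_nᶜ) ≤ μ(rangeSum ≥ R) + ∫ μ(dX) sigmaSum` (the hard core holds almost surely, (3.2), and
Markov's inequality for the event `sigmaSum ≥ 1`). [cite: Richthammer2007, §5.2 (p. 11) and §6.8 (p. 17)] -/
theorem measure_compl_goodSet_le {z : ℝ} {μ : Measure (PointConfig E2)} (hμ : IsGibbs z μ) (τ : ℝ)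
    (R : ℕ) (n n' : ℕ) (ε : ℝ) :
    μ (goodSet τ R n n' ε)ᶜ ≤ μ {X | (R : ℝ≥0∞) ≤ rangeSum ε n' X} + ∫⁻ X, sigmaSum τ R n ε X ∂μ := by
  have hsub : (goodSet τ R n n' ε)ᶜ ⊆ {X | ¬ IsHardCore X} ∪
      ({X | (R : ℝ≥0∞) ≤ rangeSum ε n' X} ∪ {X | (1 : ℝ≥0∞) ≤ sigmaSum τ R n ε X}) := by
    intro X hX
    simp only [goodSet, mem_compl_iff, mem_setOf_eq, not_and_or, not_lt] at hX
    rcases hX with h | h | h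
    · exact Or.inl h
    · exact Or.inr (Or.inl h)
    · exact Or.inr (Or.inr h)
  have h0 : μ {X | ¬ IsHardCore X} = 0 := by
    have := hμ.ae_isHardCore
    rw [ae_iff] at this
    exact this
  have hMarkov : μ {X | (1 : ℝ≥0∞) ≤ sigmaSum τ R n ε X} ≤ ∫⁻ X, sigmaSum τ R n ε X ∂μ := by
    have h := meas_ge_le_lintegral_div (measurable_sigmaSum τ R n ε).aemeasurable (μ := μ)
      one_ne_zero ENNReal.one_ne_top
    rwa [div_one] at h
  calc μ (goodSet τ R n n' ε)ᶜ
      ≤ μ ({X | ¬ IsHardCore X} ∪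
          ({X | (R : ℝ≥0∞) ≤ rangeSum ε n' X} ∪ {X | (1 : ℝ≥0∞) ≤ sigmaSum τ R n ε X})) := measure_mono hsub
    _ ≤ μ {X | ¬ IsHardCore X} +
          μ ({X | (R : ℝ≥0∞) ≤ rangeSum ε n' X} ∪ {X | (1 : ℝ≥0∞) ≤ sigmaSum τ R n ε X}) := measure_union_le _ _
    _ ≤ 0 + (μ {X | (R : ℝ≥0∞) ≤ rangeSum ε n' X} + μ {X | (1 : ℝ≥0∞) ≤ sigmaSum τ R n ε X}) := by
          rw [h0]
          exact add_le_add le_rfl (measure_union_le _ _)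
    _ ≤ _ := by
          rw [zero_add]
          exact add_le_add le_rfl hMarkov

/-- **Richthammer 2007, Lemma 13 with the choice of `R` (§5.2), for the hard-disc model — proved.**
Let `z > 0`, `μ` a Gibbs measure, `ε > 0` with `z λ²(K_ε ∖ K) < 1` ((5.1)), `n' ∈ ℕ`, `τ ∈ ℝ` and
`δ > 0`. Then there is an integer `R > n'` such that for all sufficiently large `n`,
`μ(G_nᶜ) ≤ δ` for the good set `goodSet τ R n n' ε` ("If `n ≥ R + 1` is chosen big enough, then
`μ(G_nᶜ) ≤ δ`"). [cite: Richthammer2007, §5.2 (p. 11) and §5.5 Lemma 13 (p. 12), proof §6.8 (pp. 17–18)] -/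
theorem Richthammer2007_lemma13 {z : ℝ} (hz : 0 < z) {μ : Measure (PointConfig E2)} (hμ : IsGibbs z μ)
    {ε : ℝ} (hε : 0 < ε)
    (hsmall : ENNReal.ofReal z * volume (Metric.ball (0 : E2) (1 + ε) \ Metric.closedBall 0 1) < 1)
    (n' : ℕ) (τ : ℝ) {δ : ℝ} (hδ : 0 < δ) :
    ∃ R : ℕ, n' < R ∧ ∀ᶠ n : ℕ in atTop, μ (goodSet τ R n n' ε)ᶜ ≤ ENNReal.ofReal δ := by
  obtain ⟨R, hRn', hR⟩ := exists_radius hz hμ hsmall n' hδ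
  refine ⟨R, hRn', ?_⟩
  have ht := tendsto_lintegral_sigmaSum hz hμ τ hε hsmall (R : ℝ)
  have hpos : (0 : ℝ≥0∞) < ENNReal.ofReal (δ / 2) := ENNReal.ofReal_pos.2 (by positivity)
  filter_upwards [(tendsto_order.1 ht).2 _ hpos] with n hn
  calc μ (goodSet τ R n n' ε)ᶜ ≤ μ {X | (R : ℝ≥0∞) ≤ rangeSum ε n' X} + ∫⁻ X, sigmaSum τ R n ε X ∂μ :=
        measure_compl_goodSet_le hμ τ R n n' ε
    _ ≤ ENNReal.ofReal (δ / 2) + ENNReal.ofReal (δ / 2) := add_le_add hR hn.le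
    _ = ENNReal.ofReal δ := by
        rw [← ENNReal.ofReal_add (by positivity) (by positivity)]
        congr 1
        ring

/-- **The standing choice (5.1) of `ε` is possible**: there is `ε > 0` with `z λ²(K_ε ∖ K) < 1`
(the annuli `K_ε ∖ K` decrease to `∅` as `ε ↓ 0`, so their area tends to `0`).
[cite: Richthammer2007, §5.1 (5.1) (p. 10)] -/
theorem exists_eps_small (z : ℝ) :
    ∃ ε : ℝ, 0 < ε ∧
      ENNReal.ofReal z * volume (Metric.ball (0 : E2) (1 + ε) \ Metric.closedBall 0 1) < 1 := by
  set s : ℕ → Set E2 := fun k => Metric.ball (0 : E2) (1 + ((k : ℝ) + 1)⁻¹) \ Metric.closedBall 0 1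
    with hs
  have hanti : Antitone s := by
    intro a b hab v hv
    refine ⟨Metric.ball_subset_ball ?_ hv.1, hv.2⟩
    have : ((b : ℝ) + 1)⁻¹ ≤ ((a : ℝ) + 1)⁻¹ := by
      apply inv_anti₀ (by positivity)
      exact_mod_cast Nat.succ_le_succ hab
    linarith
  have hmem : ∀ k : ℕ, ∀ v : E2, v ∈ s k → ‖v‖ < 1 + ((k : ℝ) + 1)⁻¹ ∧ 1 < ‖v‖ := by
    intro k v hv
    obtain ⟨h1, h2⟩ := hv
    rw [Metric.mem_ball, dist_zero_right] at h1
    rw [Metric.mem_closedBall, dist_zero_right, not_le] at h2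
    exact ⟨h1, h2⟩
  have hinter : ⋂ k, s k = ∅ := by
    ext x
    simp only [mem_iInter, mem_empty_iff_false, iff_false, not_forall]
    by_contra hall
    push Not at hall
    have h0 := hmem 0 x (hall 0)
    have hpos : 0 < ‖x‖ - 1 := by linarith [h0.2]
    obtain ⟨k, hk⟩ := exists_nat_gt (1 / (‖x‖ - 1))
    have hk' := hmem k x (hall k)
    have h1 : ‖x‖ - 1 < ((k : ℝ) + 1)⁻¹ := by linarith [hk'.1]
    have h2 : 1 / (‖x‖ - 1) < (k : ℝ) + 1 := by linarith
    rw [div_lt_iff₀ hpos] at h2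
    rw [lt_inv_comm₀ hpos (by positivity)] at h1
    rw [inv_eq_one_div, lt_div_iff₀ hpos] at h1
    linarith
  have hfin : ∃ i, volume (s i) ≠ ⊤ :=
    ⟨0, (lt_of_le_of_lt (measure_mono fun v hv => hv.1) measure_ball_lt_top).ne⟩
  have htend : Tendsto (fun k => volume (s k)) atTop (𝓝 (volume (⋂ k, s k))) :=
    tendsto_measure_iInter_atTop
      (fun k => (measurableSet_ball.diff measurableSet_closedBall).nullMeasurableSet) hanti hfin
  rw [hinter, measure_empty] at htend
  have htend' : Tendsto (fun k => ENNReal.ofReal z * volume (s k)) atTop (𝓝 0) := by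
    have := ENNReal.Tendsto.const_mul (a := ENNReal.ofReal z) htend (Or.inr ENNReal.ofReal_ne_top)
    simpa using this
  obtain ⟨k, hk⟩ := ((tendsto_order.1 htend').2 1 zero_lt_one).exists
  exact ⟨((k : ℝ) + 1)⁻¹, by positivity, hk⟩

end Literature.Barriers.AtomisticToContinuum.HardDisk

end
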